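import Mathlib
import Summits.ValiantsHypothesis.ValiantsHypothesis.Theorems.FifoMatchingNNNotVPDivisionSplitOfCore
import Summits.ValiantsHypothesis.ValiantsHypothesis.Theorems.FifoMatchingNNNotVPSupportFnCircuitLowerBound
import Summits.ValiantsHypothesis.ValiantsHypothesis.Theorems.FifoMatchingNNNotVPSpreadCofactorLowDegree
import HarnessLib

/-!
# Route FifoMatching — crux `NNNotVP` (stmt-ValiantsHypothesis-11615), line `division_split`:
# the line from its SHARPENED open cores, by name

Registered line `Cruxes/NNNotVP/Lines/division_split.lean` (`NNNotVP ⟸ Z ∧ NNDivisionHard`,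
`NNDivisionHard ⟸ A ∧ B1 ∧ B2`; B1 landed).  After the reductions landed for this line —
stub A ⟸ a super-quasi-polynomial lower bound on `circuitSizeOver monotoneBasis` of nest-free
perfect-matching existence (`supportFnHard_of_circuitSizeOver_lowerBound`), and
stub B2 ⟺ its hyper-degree tier (`spreadCofactorReduction_iff_hyperDegree`) — the line reads:

* `nnDivisionHard_of_monotoneBoolean_of_hyperB2` — (monotone Boolean circuit lower bound for
  NFPM-existence) → (B2 for cofactors of total degree `> 2^⌊n^{1/8}⌋`) →
  `Theses.FifoMatching.NNDivisionHard` (item stmt-21181);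
* `nnNotVP_of_monotoneBoolean_of_hyperB2` — `Theses.DivisionGap.ZeroOneTransfer` (item stmt-5066) →
  the same two → `Theses.FifoMatching.NNNotVP` (item stmt-11615).

Honest framing: compositions of landed reductions; all three inputs are OPEN, so are
`NNDivisionHard`, `NNNotVP` and `VP ≠ VNP` (NOT proved).  No definitions, no named facts.
-/

noncomputable section

-- Sub = Summit single-conjunct layout: the duplicated namespace component is mandated by the tree.
set_option linter.dupNamespace false

namespace Summit.ValiantsHypothesis.ValiantsHypothesis.Theorems.FifoMatching.NNNotVP.DivisionSplit

open MvPolynomial Literature.Computability.AlgebraicComplexity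
open Literature.Computability.Complexity
open scoped NNReal BigOperators Classical

/-- **`NNDivisionHard` from a monotone Boolean circuit lower bound and hyper-degree cofactor
surgery** (by name: `core_of_circuitSizeOver_lowerBound`, `spreadCofactorReduction_iff_hyperDegree`,
`nnDivisionHard_of_core`). [folklore] -/
theorem nnDivisionHard_of_monotoneBoolean_of_hyperB2
    (hB : ∀ c : ℕ, ∃ n₀ : ℕ, ∀ n ≥ n₀, 2 ^ ((Nat.log 2 n + c) ^ c) <
      circuitSizeOver monotoneBasis
        (fun x : σ n → Bool => decide (SuppFn (NN n) (Finset.univ.filter fun e => x e = true))))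
    (hB2 : ∃ k : ℕ, ∀ (n : ℕ) (h : MvPolynomial (σ n) ℝ≥0), h ≠ 0 →
      2 ^ Nat.sqrt (Nat.sqrt (Nat.sqrt n)) < h.totalDegree →
      ∃ h' : MvPolynomial (σ n) ℝ≥0, (∃ m ∈ h'.support, m.support.card ≤ (Nat.log 2 n + k) ^ k) ∧
        complexity (NN n * h') ≤
          2 ^ ((Nat.log 2 n + Nat.log 2 (complexity (NN n * h) + complexity h) + k) ^ k)) :
    Summit.ValiantsHypothesis.ValiantsHypothesis.Theses.FifoMatching.NNDivisionHard :=
  nnDivisionHard_of_core (core_of_circuitSizeOver_lowerBound hB)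
    (spreadCofactorReduction_iff_hyperDegree.2 hB2)

/-- **`NNNotVP` from the shared transfer, a monotone Boolean circuit lower bound and hyper-degree
cofactor surgery** — the whole line `division_split` from its three OPEN inputs in sharpened form
(by name: `nnNotVP_of_core`). [folklore] -/
theorem nnNotVP_of_monotoneBoolean_of_hyperB2
    (hZ : Summit.ValiantsHypothesis.ValiantsHypothesis.Theses.DivisionGap.ZeroOneTransfer)
    (hB : ∀ c : ℕ, ∃ n₀ : ℕ, ∀ n ≥ n₀, 2 ^ ((Nat.log 2 n + c) ^ c) <
      circuitSizeOver monotoneBasis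
        (fun x : σ n → Bool => decide (SuppFn (NN n) (Finset.univ.filter fun e => x e = true))))
    (hB2 : ∃ k : ℕ, ∀ (n : ℕ) (h : MvPolynomial (σ n) ℝ≥0), h ≠ 0 →
      2 ^ Nat.sqrt (Nat.sqrt (Nat.sqrt n)) < h.totalDegree →
      ∃ h' : MvPolynomial (σ n) ℝ≥0, (∃ m ∈ h'.support, m.support.card ≤ (Nat.log 2 n + k) ^ k) ∧
        complexity (NN n * h') ≤
          2 ^ ((Nat.log 2 n + Nat.log 2 (complexity (NN n * h) + complexity h) + k) ^ k)) :
    Summit.ValiantsHypothesis.ValiantsHypothesis.Theses.FifoMatching.NNNotVP :=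
  nnNotVP_of_core hZ (core_of_circuitSizeOver_lowerBound hB)
    (spreadCofactorReduction_iff_hyperDegree.2 hB2)

end Summit.ValiantsHypothesis.ValiantsHypothesis.Theorems.FifoMatching.NNNotVP.DivisionSplit

end
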